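import Mathlib
import HarnessLib
import Summits.QuantumFields.YangMills.Theses.ScalingWindowSplit
import Summits.QuantumFields.YangMills.Theorems.MirrorModularBoostsHypercubicLimitSubschemeDefs
import Summits.QuantumFields.YangMills.Theorems.MirrorModularBoostsHypercubicLimitFunctionalBoundPlanes
import Summits.QuantumFields.YangMills.Theorems.MirrorModularBoostsHypercubicLimitClosureHalvesDefs
import Summits.QuantumFields.YangMills.Theorems.PencilRigidityWeakCouplingHypercubicLimitOfRpCoreDisjoint
import Summits.QuantumFields.YangMills.Theorems.ScalingWindowSplitExistenceLegFromLatticeGapped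
import Literature.MathematicalPhysics.QuantumLattice.EuclideanAction

/-!
# Line `Sketch` of crux `WeakCouplingHypercubicLimit` (stmt-QuantumFields-16120) — reshape r17 (lead c8):
# the heart is SUPPLIED by the three lattice items of route `ScalingWindowSplit`

The registered heart of the line (S6i `stub_rpCoreDisjoint`, r15/r16) is the DISJOINT RP CORE

  `H16 := ∀ G compact simple, ∃ r sch, weak coupling ∧ PolyVolume ∧ PolyRenorm ∧ UniformFunctionalBoundPlanes ∧
          (∃ Δ C, 0 < Δ ∧ RPSpectral r sch Δ C) ∧ (one κ₃ floor on some pairwise-disjoint real triple)`,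

and `weakCouplingHypercubicLimit_of_rpCoreDisjoint` (Theorems/…OfRpCoreDisjoint.lean) closes the crux from it.  Leads
c5/c6/c7 asked the planners to promote that core; the planners filed it SPLIT along the renormalisation seam as the three
crux items of route `ScalingWindowSplit` — W₁ `GapAtCorrelationLength` (stmt-QuantumFields-18927: IR, `∃`-form,
renormalisation-free), U_R `SelfNormalisedMomentBoundsR` (stmt-QuantumFields-18014: `k`-uniform plane-resolved `n!`-moment
bounds of the SELF-NORMALISED field) and W₂ᴳ `SelfNormalisedSkewnessGapped` (stmt-QuantumFields-18170: the `κ₃` floor of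
the self-normalised field, gapped).  This file proves that the three items supply the heart VERBATIM, hence the crux through
THIS line's composition:

* `rpCoreDisjointDatum_of_latticeInequalities` — the seam at one witness: from a scheme `sch` at weak coupling with
  polynomial volumes, the RP-spectral clustering at rate `Δ > 0`, the polynomial floor `a_k^p ≤ T⁰_k(u, θu)` of the BARE
  truncated two-point function, the self-normalised moment bounds and a `κ₃` floor for the self-normalised scheme `canon`
  (`c'_k = 1/√T⁰_k(u,θu)`, `m'_k = ⟨tr U_p⟩_k`), the tail sub-scheme `subseq canon (· + k₀)` carries every conjunct of the
  heart: weak coupling and `PolyVolume` (read `β, a, L` only), `PolyRenorm` (`1/√T⁰_k ≤ a_k⁻ᵖ` once the floor holds and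
  `a_k ≤ 1`), `UniformFunctionalBoundPlanes` (moment bounds ⇒ functional bounds, the landed `stub_functionalBoundPlanes`),
  `RPSpectral` (reads `β, a, L` only) and the `κ₃` floor (eventual clauses restrict to tails);
* `stub_rpCoreDisjointOfSWS` (registered sub-goal of the skeleton, r17) — W₁ → U_R → W₂ᴳ → H16 BY NAME (H16 = the registered signature of
  `stub_rpCoreDisjoint`; the items' witness lives on `borel G`, transported to any `BorelSpace` instance by `subst`);
* `weakCouplingHypercubicLimit_of_scalingWindowSplit` — W₁ → U_R → W₂ᴳ → `PencilRigidity.WeakCouplingHypercubicLimit`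
  through the line (`weakCouplingHypercubicLimit_of_rpCoreDisjoint`), and `weakCouplingHypercubicLimit_of_scalingWindowSplit'`,
  the same implication through the route's own typed split (`existenceLegFromLatticeGapped_proof`) and the sibling tie — the
  square commutes at the level of statements.

So the line is complete as a reduction: its single open stub is the conjunction of three FILED items (monotone: H16 is
weaker than W₁ ∧ U_R ∧ W₂ᴳ, the latter two being `∀`-scheme statements).

References: Glimm–Jaffe, *Quantum Physics* (1987) §6.1, §19.1 (truncated functions, multiplicative renormalisation);
Osterwalder–Seiler, Ann. Phys. 110 (1978) §2 (transfer matrix of Wilson's theory).  No definitions, no named facts.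
-/

noncomputable section

open scoped SchwartzMap BigOperators Topology
open MeasureTheory Filter Topology
open Literature.MathematicalPhysics.AQFT Literature.MathematicalPhysics.QuantumLattice
open Literature.MathematicalPhysics.QuantumFieldTheory
open Summit.QuantumFields.YangMills.Cruxes.HypercubicLimit.CouplingResponse

namespace Summit.QuantumFields.YangMills.Theorems.WeakCouplingHypercubicLimit.TraceNormColdPressure

section Seam

variable {G : Type} [Group G] [TopologicalSpace G] [IsTopologicalGroup G] [CompactSpace G]
  [MeasurableSpace G] [BorelSpace G]

/-- **The seam at one witness: lattice inequalities ⇒ the disjoint RP core datum on the tail of the self-normalised scheme.**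
Given `r`, a scheme `sch` at weak coupling with polynomial volume growth, `Δ > 0` with the RP-spectral clustering of reflected
slab functionals (the body of `RPSpectral r sch Δ C`), a real test `u` and `p` with eventually the polynomial floor
`a_k^p ≤ T⁰_k(u, θu)` of the BARE truncated two-point function, the `k`-uniform plane-resolved `n!`-moment bounds of the
SELF-NORMALISED scheme `canon` (`c'_k = 1/√T⁰_k(u,θu)`, `m'_k = ⟨tr U_p⟩_k`, `a, β, L` unchanged) and a `κ₃` floor for
`canon` on a pairwise-disjoint real triple: some scheme (the tail `subseq canon (· + k₀)`, `k₀` past the floor and `a_k ≤ 1`)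
is at weak coupling with polynomial volumes and polynomial renormalisation (`|c'_k| = 1/√T⁰_k ≤ a_k⁻ᵖ`), obeys
`UniformFunctionalBoundPlanes` (moment ⇒ functional bounds, `stub_functionalBoundPlanes`) and `RPSpectral … Δ C` (the clause
reads `β, a, L` only), and keeps the `κ₃` floor. [cite: GlimmJaffe1987, §6.1 and §19.1] -/
theorem rpCoreDisjointDatum_of_latticeInequalities (r : LatticeRep G) (sch : SpeciesScheme (YMSpecies G))
    (u : 𝓢(EuclideanSpace ℝ (Fin 4), ℝ)) (p : ℕ) (Δ C : ℝ) :
    let bare : SpeciesScheme (YMSpecies G) := { sch with c := fun _ _ => 1, m := fun _ _ => 0 }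
    let T : 𝓢(EuclideanSpace ℝ (Fin 4), ℝ) → ℕ → ℝ := fun w k =>
      latticeSchwinger r.ρ bare (fun s => s.F) k (1 + 1) (fun _ => r.curvature) ![w, thetaTest 4 w] -
        latticeSchwinger r.ρ bare (fun s => s.F) k 1 (fun _ => r.curvature) ![w] *
          latticeSchwinger r.ρ bare (fun s => s.F) k 1 (fun _ => r.curvature) ![thetaTest 4 w]
    let canon : SpeciesScheme (YMSpecies G) :=
      { sch with
        c := fun _ k => (Real.sqrt (T u k))⁻¹
        m := fun _ k => ∫ U, r.curvature.F (torusLift (sch.side k) U) ∂(wilsonMeasure r.ρ (sch.β k)) }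
    sch.HasWeakCouplingLimit →
    (∃ N : ℕ, 1 ≤ N ∧ ∀ᶠ k in Filter.atTop, (sch.a k)⁻¹ ≤ (sch.a k * (sch.L k : ℝ)) ^ N) →
    0 < Δ →
    (∀ᶠ k in Filter.atTop, ∀ (S₀ T₀ n : ℕ), sch.L k ≤ S₀ → 2 * (T₀ + n + 1) ≤ S₀ →
      ∀ (Y : LGConfig 4 G → ℝ) (B : ℝ), Measurable Y → (∀ U, |Y U| ≤ B) →
        DependsOn Y {e : Literature.MathematicalPhysics.QuantumLattice.ZdEdge 4 |
          1 ≤ e.1 0 ∧ e.1 0 + (if e.2 = 0 then 1 else 0) ≤ T₀} →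
        |(∫ U, Y (torusLift (2 * S₀ + 1) (GaugeConfig.timeReflect U)) *
              Y (configShift (-Pi.single 0 (n : ℤ)) (torusLift (2 * S₀ + 1) U))
            ∂(wilsonMeasure r.ρ (sch.β k) : Measure (GaugeConfig 4 (2 * S₀ + 1) G))) -
          (∫ U, Y (torusLift (2 * S₀ + 1) U)
            ∂(wilsonMeasure r.ρ (sch.β k) : Measure (GaugeConfig 4 (2 * S₀ + 1) G))) ^ 2| ≤
          Real.exp (-(Δ * sch.a k * n)) *
            ((∫ U, Y (torusLift (2 * S₀ + 1) (GaugeConfig.timeReflect U)) * Y (torusLift (2 * S₀ + 1) U)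
                ∂(wilsonMeasure r.ρ (sch.β k) : Measure (GaugeConfig 4 (2 * S₀ + 1) G))) -
              (∫ U, Y (torusLift (2 * S₀ + 1) U)
                ∂(wilsonMeasure r.ρ (sch.β k) : Measure (GaugeConfig 4 (2 * S₀ + 1) G))) ^ 2) +
          C * B ^ 2 * Real.exp (-(Δ * sch.a k * S₀))) →
    (∀ᶠ k in Filter.atTop, (sch.a k) ^ p ≤ T u k) →
    (∃ (s : ℕ) (C₀ C₁ : ℝ), ∀ (n : ℕ)
        (F : Fin n → {q : Fin 4 × Fin 4 // q.1 < q.2} → 𝓢(EuclideanSpace ℝ (Fin 4), ℝ)),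
      (∀ i, ∑ q, schwartzNorm s (ofRealTest (F i q)) ≤ 1) →
      (∀ i j, i ≠ j → ∀ q q', Disjoint (tsupport (F i q)) (tsupport (F j q'))) →
      ∀ k : ℕ, |∫ U, ∏ i, ∑ q : {q : Fin 4 × Fin 4 // q.1 < q.2},
        smearedLatticeField (plaquetteObs r.ρ 0 q.1.1 q.1.2)
          (Literature.Probability.LatticeModels.box 4 (canon.L k)) (canon.a k) (canon.c r.curvature k)
          (canon.m r.curvature k / 6) (F i q) (torusLift (canon.side k) U)
        ∂(wilsonMeasure r.ρ (canon.β k) : Measure (GaugeConfig 4 (canon.side k) G))| ≤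
        C₀ * C₁ ^ n * n.factorial) →
    (∃ (f g h : 𝓢(EuclideanSpace ℝ (Fin 4), ℝ)) (δ : ℝ),
      Disjoint (tsupport f) (tsupport g) ∧ Disjoint (tsupport f) (tsupport h) ∧
      Disjoint (tsupport g) (tsupport h) ∧ 0 < δ ∧
      ∀ᶠ k in Filter.atTop, δ ≤
        |latticeSchwinger r.ρ canon (fun s => s.F) k 3 (fun _ => r.curvature) ![f, g, h] -
          latticeSchwinger r.ρ canon (fun s => s.F) k 1 (fun _ => r.curvature) ![f] *
            latticeSchwinger r.ρ canon (fun s => s.F) k 2 (fun _ => r.curvature) ![g, h] -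
          latticeSchwinger r.ρ canon (fun s => s.F) k 1 (fun _ => r.curvature) ![g] *
            latticeSchwinger r.ρ canon (fun s => s.F) k 2 (fun _ => r.curvature) ![f, h] -
          latticeSchwinger r.ρ canon (fun s => s.F) k 1 (fun _ => r.curvature) ![h] *
            latticeSchwinger r.ρ canon (fun s => s.F) k 2 (fun _ => r.curvature) ![f, g] +
          2 * (latticeSchwinger r.ρ canon (fun s => s.F) k 1 (fun _ => r.curvature) ![f] *
            latticeSchwinger r.ρ canon (fun s => s.F) k 1 (fun _ => r.curvature) ![g] *
            latticeSchwinger r.ρ canon (fun s => s.F) k 1 (fun _ => r.curvature) ![h])|) →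
    ∃ sch' : SpeciesScheme (YMSpecies G),
      sch'.HasWeakCouplingLimit ∧ PolyVolume sch' ∧ PolyRenorm r sch' ∧ UniformFunctionalBoundPlanes r sch' ∧
      (∃ Δ' C' : ℝ, 0 < Δ' ∧ RPSpectral r sch' Δ' C') ∧
      (∃ (f g h : 𝓢(EuclideanSpace ℝ (Fin 4), ℝ)) (δ : ℝ),
        Disjoint (tsupport f) (tsupport g) ∧ Disjoint (tsupport f) (tsupport h) ∧
        Disjoint (tsupport g) (tsupport h) ∧ 0 < δ ∧
        ∀ᶠ k in atTop, δ ≤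
          |latticeSchwinger r.ρ sch' (fun s => s.F) k 3 (fun _ => r.curvature) ![f, g, h] -
            latticeSchwinger r.ρ sch' (fun s => s.F) k 1 (fun _ => r.curvature) ![f] *
              latticeSchwinger r.ρ sch' (fun s => s.F) k 2 (fun _ => r.curvature) ![g, h] -
            latticeSchwinger r.ρ sch' (fun s => s.F) k 1 (fun _ => r.curvature) ![g] *
              latticeSchwinger r.ρ sch' (fun s => s.F) k 2 (fun _ => r.curvature) ![f, h] -
            latticeSchwinger r.ρ sch' (fun s => s.F) k 1 (fun _ => r.curvature) ![h] *
              latticeSchwinger r.ρ sch' (fun s => s.F) k 2 (fun _ => r.curvature) ![f, g] +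
            2 * (latticeSchwinger r.ρ sch' (fun s => s.F) k 1 (fun _ => r.curvature) ![f] *
              latticeSchwinger r.ρ sch' (fun s => s.F) k 1 (fun _ => r.curvature) ![g] *
              latticeSchwinger r.ρ sch' (fun s => s.F) k 1 (fun _ => r.curvature) ![h])|) := by
  intro bare T canon hw hpv hΔ hrp hfl hUMB hK3
  -- the tail `k ≥ k₀`: the floor holds and `a_k ≤ 1`
  have ha1 : ∀ᶠ k in atTop, sch.a k ≤ 1 := sch.tendsto_a.eventually_le_const zero_lt_one
  obtain ⟨k₀, hk₀⟩ := Filter.eventually_atTop.1 (hfl.and ha1)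
  have hTpos : ∀ k, k₀ ≤ k → 0 < T u k := fun k hk =>
    (pow_pos (sch.a_pos k) p).trans_le (hk₀ k hk).1
  have hφ : StrictMono fun k : ℕ => k + k₀ := fun a b h => Nat.add_lt_add_right h k₀
  refine ⟨subseq canon (fun k => k + k₀) hφ, hasWeakCouplingLimit_subseq canon _ hφ hw,
    polyVolume_subseq canon _ hφ hpv, ?_, ?_, ⟨Δ, C, hΔ, ?_⟩, ?_⟩
  · -- `PolyRenorm` on the tail: `|c'_k| = 1/√T⁰_k ≤ a_k⁻ᵖ`
    refine ⟨p, fun k => ?_⟩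
    show |(Real.sqrt (T u (k + k₀)))⁻¹| ≤ (sch.a (k + k₀))⁻¹ ^ p
    obtain ⟨hflk, hak⟩ := hk₀ (k + k₀) (Nat.le_add_left k₀ k)
    have hT : 0 < T u (k + k₀) := hTpos _ (Nat.le_add_left k₀ k)
    have ha : 0 < sch.a (k + k₀) := sch.a_pos _
    rw [abs_of_pos (inv_pos.2 (Real.sqrt_pos.2 hT)), inv_pow]
    refine inv_anti₀ (pow_pos ha p) (Real.le_sqrt_of_sq_le ?_)
    calc (sch.a (k + k₀) ^ p) ^ 2 = sch.a (k + k₀) ^ p * sch.a (k + k₀) ^ p := sq _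
      _ ≤ sch.a (k + k₀) ^ p * 1 :=
        mul_le_mul_of_nonneg_left (pow_le_one₀ ha.le hak) (pow_nonneg ha.le p)
      _ ≤ T u (k + k₀) := by rw [mul_one]; exact hflk
  · -- `UniformFunctionalBoundPlanes` on the tail: moment bounds ⇒ functional bounds
    exact stub_functionalBoundPlanes G r _ (polyVolume_subseq canon _ hφ hpv)
      (Summit.QuantumFields.YangMills.Theorems.ScalingWindowSplit.uniformMomentBoundsPlanes_subseq r canon _ hφ hUMB)
  · -- `RPSpectral` on the tail (the clause reads `β, a, L` only, unchanged by the self-normalisation)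
    exact eventually_subseq hφ hrp
  · -- the `κ₃` floor on the tail
    obtain ⟨f, g, h, δ, hfg, hfh, hgh, hδ, hev⟩ := hK3
    exact ⟨f, g, h, δ, hfg, hfh, hgh, hδ, eventually_subseq hφ hev⟩

end Seam

/-- **The three lattice items of route `ScalingWindowSplit` supply the heart of line `Sketch` VERBATIM**: W₁
`GapAtCorrelationLength` (stmt-QuantumFields-18927) → U_R `SelfNormalisedMomentBoundsR` (stmt-QuantumFields-18014) → W₂ᴳ
`SelfNormalisedSkewnessGapped` (stmt-QuantumFields-18170) → the DISJOINT RP CORE (the registered signature of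
`stub_rpCoreDisjoint`).  Fix a compact simple `G` with any Borel σ-algebra (transported to `borel G` by `subst`); W₁ gives the
witness `(r, sch, u, p, M, Δ, C)`; U_R and W₂ᴳ at that witness (W₂ᴳ also reads W₁'s gap) give the self-normalised moment
bounds and the `κ₃` floor; `rpCoreDisjointDatum_of_latticeInequalities` assembles the datum. [cite: GlimmJaffe1987, §6.1 and §19.1] -/
theorem stub_rpCoreDisjointOfSWS :
    Summit.QuantumFields.YangMills.Theses.ScalingWindowSplit.GapAtCorrelationLength →
    Summit.QuantumFields.YangMills.Theses.ScalingWindowSplit.SelfNormalisedMomentBoundsR →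
    Summit.QuantumFields.YangMills.Theses.ScalingWindowSplit.SelfNormalisedSkewnessGapped →
    ∀ (G : Type) [Group G] [TopologicalSpace G] [IsTopologicalGroup G] [CompactSpace G]
      [MeasurableSpace G] [BorelSpace G], IsCompactSimpleLieGroup G →
      ∃ (r : LatticeRep G) (sch : SpeciesScheme (YMSpecies G)),
        sch.HasWeakCouplingLimit ∧ PolyVolume sch ∧ PolyRenorm r sch ∧ UniformFunctionalBoundPlanes r sch ∧
        (∃ Δ C : ℝ, 0 < Δ ∧ RPSpectral r sch Δ C) ∧
        (∃ (f g h : 𝓢(EuclideanSpace ℝ (Fin 4), ℝ)) (δ : ℝ),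
          Disjoint (tsupport f) (tsupport g) ∧ Disjoint (tsupport f) (tsupport h) ∧
          Disjoint (tsupport g) (tsupport h) ∧ 0 < δ ∧
          ∀ᶠ k in atTop, δ ≤
            |latticeSchwinger r.ρ sch (fun s => s.F) k 3 (fun _ => r.curvature) ![f, g, h] -
              latticeSchwinger r.ρ sch (fun s => s.F) k 1 (fun _ => r.curvature) ![f] *
                latticeSchwinger r.ρ sch (fun s => s.F) k 2 (fun _ => r.curvature) ![g, h] -
              latticeSchwinger r.ρ sch (fun s => s.F) k 1 (fun _ => r.curvature) ![g] *
                latticeSchwinger r.ρ sch (fun s => s.F) k 2 (fun _ => r.curvature) ![f, h] -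
              latticeSchwinger r.ρ sch (fun s => s.F) k 1 (fun _ => r.curvature) ![h] *
                latticeSchwinger r.ρ sch (fun s => s.F) k 2 (fun _ => r.curvature) ![f, g] +
              2 * (latticeSchwinger r.ρ sch (fun s => s.F) k 1 (fun _ => r.curvature) ![f] *
                latticeSchwinger r.ρ sch (fun s => s.F) k 1 (fun _ => r.curvature) ![g] *
                latticeSchwinger r.ρ sch (fun s => s.F) k 1 (fun _ => r.curvature) ![h])|) := by
  intro hW hU hS G _ _ _ _ _ _ hG
  have hmeas : ‹MeasurableSpace G› = borel G := BorelSpace.measurable_eq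
  subst hmeas
  letI : MeasurableSpace G := borel G
  haveI : BorelSpace G := ⟨rfl⟩
  obtain ⟨r, sch, u, p, M, Δ, C, hw, hpv, hΔ, hgap, hrp, hu, hfw⟩ := hW G hG
  obtain ⟨sch', h'⟩ := rpCoreDisjointDatum_of_latticeInequalities r sch u p Δ C hw hpv hΔ hrp
    (hfw.mono fun k hk => hk.1) (hU G r sch u p M hw hpv hu hfw) (hS G r sch u p M Δ hw hΔ hgap hpv hu hfw)
  exact ⟨r, sch', h'⟩

/-- **The crux `PencilRigidity.WeakCouplingHypercubicLimit` (stmt-QuantumFields-16120) from the three lattice items of route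
`ScalingWindowSplit`, THROUGH THE LINE**: W₁ → U_R → W₂ᴳ supply the disjoint RP core (`stub_rpCoreDisjointOfSWS`),
which closes the crux by the line's landed composition `weakCouplingHypercubicLimit_of_rpCoreDisjoint`. [folklore] -/
theorem weakCouplingHypercubicLimit_of_scalingWindowSplit
    (hW : Summit.QuantumFields.YangMills.Theses.ScalingWindowSplit.GapAtCorrelationLength)
    (hU : Summit.QuantumFields.YangMills.Theses.ScalingWindowSplit.SelfNormalisedMomentBoundsR)
    (hS : Summit.QuantumFields.YangMills.Theses.ScalingWindowSplit.SelfNormalisedSkewnessGapped) :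
    Summit.QuantumFields.YangMills.Theses.PencilRigidity.WeakCouplingHypercubicLimit :=
  weakCouplingHypercubicLimit_of_rpCoreDisjoint (stub_rpCoreDisjointOfSWS hW hU hS)

/-- **The same implication through the route's own typed split** (cross-check: the square commutes at the level of
statements): `existenceLegFromLatticeGapped_proof` gives `CoincidenceRotationBootstrap.HypercubicLimit` from W₁, W₂ᴳ, U_R, and
the sibling tie `stub_siblingTie` identifies it with this crux. [folklore] -/
theorem weakCouplingHypercubicLimit_of_scalingWindowSplit'
    (hW : Summit.QuantumFields.YangMills.Theses.ScalingWindowSplit.GapAtCorrelationLength)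
    (hU : Summit.QuantumFields.YangMills.Theses.ScalingWindowSplit.SelfNormalisedMomentBoundsR)
    (hS : Summit.QuantumFields.YangMills.Theses.ScalingWindowSplit.SelfNormalisedSkewnessGapped) :
    Summit.QuantumFields.YangMills.Theses.PencilRigidity.WeakCouplingHypercubicLimit :=
  SiblingTie.stub_siblingTie.mpr
    (Summit.QuantumFields.YangMills.Theorems.ScalingWindowSplit.existenceLegFromLatticeGapped_proof hW hS hU)

end Summit.QuantumFields.YangMills.Theorems.WeakCouplingHypercubicLimit.TraceNormColdPressure

end
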